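import Mathlib
import HarnessLib
import Summits.AtomisticToContinuum.Crystallization.Theorems.PricedLinkCensusSoftLayerPropagationStubBallPropagationLayers

/-!
# Local layer-propagation lemmas for the finite-ball form of Hales, *Dense Sphere Packings* §1.3 (V):
# a full layer DISC from one centre

Route `PricedLinkCensus`, crux `SoftLayerPropagation` (stmt-AtomisticToContinuum-14233), line
`Sketch`, fifth helper file for the stub `stub_ballPropagation` (frame `u₁ = triangularVec₁ 2`,
`u₂ = triangularVec₂ 2` of `LayerShells.lean`; uses `…StubBallPropagationLayers.lean`).

The tree fills the FIRST LAYER of the whole-space statement by `lattice_induction` over all of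
`ℤu₁ + ℤu₂` (`layer_subset_of_hcp`, `layer_subset_of_fcc`).  On a ball the pattern hypothesis
holds only on a disc, and the induction must stay inside it: this file propagates a property of
lattice points that spreads along contacts inside the disc `{p ∈ ℤu₁ + ℤu₂ : ‖p − c‖ ≤ R}` (`c` a
point of the layer plane) from one lattice point `p₀` with `‖p₀ − c‖² ≤ 2` to the whole disc
(`lattice_disc_induction`), by well-founded descent on `⌊3‖p − c‖²⌋`: a lattice point at squared
distance `> 8/5` from `c` has a hexagon neighbour whose squared distance is smaller by `> 1/3`
(`exists_mem_hexagonSet_norm_sq_lt`, the quantitative form of the descent step of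
`…Layers.lean`), and the lattice points within squared distance `8/5` of `c` are `p₀` or hexagon
neighbours of `p₀` (`eq_zero_or_mem_hexagonSet_of_norm_sq_lt_twelve`).  With the in-layer steps
of `…StubBallPropagationPairs.lean` (`kissingShell_add_eq_layerShell_of_hcp_dir`,
`hexagonSet_subset_kissingShell_add_of_fcc_dir`) as the step `Q i j → Q i' j'` this gives the HCP
disc ("the pattern propagates along the plane of symmetry", on a disc) and the FCC disc ("adjacent
FCC patterns interlock", on a disc): `…StubBallPropagationDiscs.lean`.

All statements are elementary ([folklore]) or cite DSP §1.3 as the tree lemmas they localise.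
-/

noncomputable section

namespace Summit.AtomisticToContinuum.Crystallization.Theorems

open Literature.Geometry.DiscreteGeometry Literature.MathematicalPhysics.StatisticalMechanics
open RealInnerProductSpace

/-! ### Lattice points near a lattice point; lattice coordinates of the hexagon -/

/-- The squared norm of a lattice vector: `‖i u₁ + j u₂‖² = 4 (i² + i j + j²)`. [folklore] -/
theorem norm_sq_lattice (i j : ℤ) :
    ‖(i : ℝ) • (triangularVec₁ 2 : EuclideanSpace ℝ (Fin 3)) + (j : ℝ) • triangularVec₂ 2‖ ^ 2 =
      4 * ((i : ℝ) ^ 2 + i * j + (j : ℝ) ^ 2) := by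
  rw [norm_sq_fin3]
  simp only [PiLp.add_apply, PiLp.smul_apply, smul_eq_mul, frameU_apply_zero, frameU_apply_one,
    frameU_apply_two, frameV_apply_zero, frameV_apply_one, frameV_apply_two, mul_zero, add_zero,
    mul_one]
  linear_combination ((j : ℝ) ^ 2) * sqrt_three_sq

/-- **A short lattice vector is `0` or a hexagon vector**: `‖i u₁ + j u₂‖² < 12` forces
`i² + ij + j² ∈ {0, 1}`. [folklore] -/
theorem eq_zero_or_mem_hexagonSet_of_norm_sq_lt_twelve {i j : ℤ}
    (h : ‖(i : ℝ) • (triangularVec₁ 2 : EuclideanSpace ℝ (Fin 3)) + (j : ℝ) • triangularVec₂ 2‖ ^ 2 < 12) :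
    (i : ℝ) • (triangularVec₁ 2 : EuclideanSpace ℝ (Fin 3)) + (j : ℝ) • triangularVec₂ 2 = 0 ∨
      (i : ℝ) • (triangularVec₁ 2 : EuclideanSpace ℝ (Fin 3)) + (j : ℝ) • triangularVec₂ 2 ∈ hexagonSet := by
  rw [norm_sq_lattice] at h
  have hQ : (i : ℝ) ^ 2 + i * j + (j : ℝ) ^ 2 < 3 := by linarith
  have hQ' : i ^ 2 + i * j + j ^ 2 < 3 := by exact_mod_cast hQ
  have hi : i ≤ 1 ∧ -1 ≤ i := by constructor <;> nlinarith [sq_nonneg (2 * j + i), sq_nonneg (2 * i + j)]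
  have hj : j ≤ 1 ∧ -1 ≤ j := by constructor <;> nlinarith [sq_nonneg (2 * i + j), sq_nonneg (2 * j + i)]
  obtain ⟨hi1, hi2⟩ := hi
  obtain ⟨hj1, hj2⟩ := hj
  interval_cases i <;> interval_cases j
  · norm_num at hQ'
  · right
    have e : ((-1 : ℤ) : ℝ) • (triangularVec₁ 2 : EuclideanSpace ℝ (Fin 3)) + ((0 : ℤ) : ℝ) • triangularVec₂ 2 =
        -triangularVec₁ 2 := by push_cast; module
    rw [e]; simp [hexagonSet]
  · right
    have e : ((-1 : ℤ) : ℝ) • (triangularVec₁ 2 : EuclideanSpace ℝ (Fin 3)) + ((1 : ℤ) : ℝ) • triangularVec₂ 2 =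
        triangularVec₂ 2 - triangularVec₁ 2 := by push_cast; module
    rw [e]; simp [hexagonSet]
  · right
    have e : ((0 : ℤ) : ℝ) • (triangularVec₁ 2 : EuclideanSpace ℝ (Fin 3)) + ((-1 : ℤ) : ℝ) • triangularVec₂ 2 =
        -triangularVec₂ 2 := by push_cast; module
    rw [e]; simp [hexagonSet]
  · left; push_cast; module
  · right
    have e : ((0 : ℤ) : ℝ) • (triangularVec₁ 2 : EuclideanSpace ℝ (Fin 3)) + ((1 : ℤ) : ℝ) • triangularVec₂ 2 =
        triangularVec₂ 2 := by push_cast; module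
    rw [e]; simp [hexagonSet]
  · right
    have e : ((1 : ℤ) : ℝ) • (triangularVec₁ 2 : EuclideanSpace ℝ (Fin 3)) + ((-1 : ℤ) : ℝ) • triangularVec₂ 2 =
        triangularVec₁ 2 - triangularVec₂ 2 := by push_cast; module
    rw [e]; simp [hexagonSet]
  · right
    have e : ((1 : ℤ) : ℝ) • (triangularVec₁ 2 : EuclideanSpace ℝ (Fin 3)) + ((0 : ℤ) : ℝ) • triangularVec₂ 2 =
        triangularVec₁ 2 := by push_cast; module
    rw [e]; simp [hexagonSet]
  · norm_num at hQ'

/-- The hexagon vectors are lattice vectors. [folklore] -/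
theorem exists_int_of_mem_hexagonSet {η : EuclideanSpace ℝ (Fin 3)} (hη : η ∈ hexagonSet) :
    ∃ a b : ℤ, η = (a : ℝ) • (triangularVec₁ 2 : EuclideanSpace ℝ (Fin 3)) + (b : ℝ) • triangularVec₂ 2 := by
  simp only [hexagonSet, Set.mem_insert_iff, Set.mem_singleton_iff] at hη
  rcases hη with rfl | rfl | rfl | rfl | rfl | rfl
  · exact ⟨1, 0, by push_cast; module⟩
  · exact ⟨-1, 0, by push_cast; module⟩
  · exact ⟨0, 1, by push_cast; module⟩
  · exact ⟨0, -1, by push_cast; module⟩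
  · exact ⟨1, -1, by push_cast; module⟩
  · exact ⟨-1, 1, by push_cast; module⟩

/-- Lattice points are horizontal. [folklore] -/
theorem lattice_apply_two (i j : ℤ) :
    ((i : ℝ) • (triangularVec₁ 2 : EuclideanSpace ℝ (Fin 3)) + (j : ℝ) • triangularVec₂ 2) 2 = 0 := by
  simp

/-! ### Quantitative descent -/

/-- **Quantitative descent step.**  If `p`, `c` lie in the layer plane and `‖p − c‖² > (4/3) t²`
(`t > 0`), some hexagon neighbour `p + η` satisfies `‖p + η − c‖² < ‖p − c‖² − (4t − 4)`
(`exists_mem_hexagonSet_norm_add_sub_lt` applied to `p/t, c/t` gives `⟪c − p, η⟫ > 2t`).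
[folklore] -/
theorem exists_mem_hexagonSet_norm_sq_lt {p c : EuclideanSpace ℝ (Fin 3)} (hp : p 2 = 0) (hc : c 2 = 0)
    {t : ℝ} (ht : 0 < t) (h : 4 / 3 * t ^ 2 < ‖p - c‖ ^ 2) :
    ∃ η ∈ hexagonSet, ‖p + η - c‖ ^ 2 < ‖p - c‖ ^ 2 - (4 * t - 4) := by
  have hp' : (t⁻¹ • p) 2 = 0 := by simp [hp]
  have hc' : (t⁻¹ • c) 2 = 0 := by simp [hc]
  have hsc : ‖t⁻¹ • p - t⁻¹ • c‖ ^ 2 = t⁻¹ ^ 2 * ‖p - c‖ ^ 2 := by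
    rw [← smul_sub, norm_smul, mul_pow, Real.norm_eq_abs, abs_of_pos (inv_pos.2 ht)]
  have h' : 4 / 3 < ‖t⁻¹ • p - t⁻¹ • c‖ ^ 2 := by
    rw [hsc]
    have ht2 : 0 < t ^ 2 := by positivity
    rw [inv_pow, lt_inv_mul_iff₀ ht2]
    linarith
  obtain ⟨η, hη, hlt⟩ := exists_mem_hexagonSet_norm_add_sub_lt hp' hc' h'
  refine ⟨η, hη, ?_⟩
  have hηn : ‖η‖ = 2 := norm_of_mem_hexagonSet hη
  -- from `‖x + η‖ < ‖x‖` with `x = (p − c)/t`: `⟪p − c, η⟫ < −2t`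
  have hx : t⁻¹ • p + η - t⁻¹ • c = t⁻¹ • (p - c) + η := by rw [smul_sub]; abel
  have h1 : ‖t⁻¹ • (p - c) + η‖ ^ 2 < ‖t⁻¹ • (p - c)‖ ^ 2 := by
    rw [← hx, smul_sub]
    exact pow_lt_pow_left₀ hlt (norm_nonneg _) two_ne_zero
  rw [norm_add_sq_real, hηn, inner_smul_left, RCLike.conj_to_real] at h1
  have h2 : t⁻¹ * ⟪p - c, η⟫ < -2 := by nlinarith
  have h3 : ⟪p - c, η⟫ < -2 * t := by
    have := mul_lt_mul_of_pos_left h2 ht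
    rwa [← mul_assoc, mul_inv_cancel₀ ht.ne', one_mul, mul_comm] at this
  have h4 : ‖p + η - c‖ ^ 2 = ‖p - c‖ ^ 2 + 2 * ⟪p - c, η⟫ + 4 := by
    have e : p + η - c = (p - c) + η := by abel
    rw [e, norm_add_sq_real, hηn]; ring
  rw [h4]; linarith

/-! ### A full disc from one centre -/

section Disc

variable {V : Set (EuclideanSpace ℝ (Fin 3))}

/-- **Disc induction on the triangular lattice.**  Let `c` be a point of the layer plane, `R` a
radius and `Q` a property of lattice points that passes from a lattice point to each of its six
hexagon neighbours lying in the disc `‖· − c‖ ≤ R`.  If `Q` holds at a lattice point `p₀` with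
`‖p₀ − c‖² ≤ 2` (e.g. the lattice point nearest to `c`), it holds at every lattice point of the disc.  (Descent on `⌊3‖p − c‖²⌋` by
`exists_mem_hexagonSet_norm_sq_lt` with `t = 13/12` down to squared distance `≤ 8/5`, where the
lattice point is `p₀` or a hexagon neighbour of `p₀`.) [folklore] -/
theorem lattice_disc_induction {Q : ℤ → ℤ → Prop} {c : EuclideanSpace ℝ (Fin 3)} (hc : c 2 = 0)
    {R : ℝ}
    (hstep : ∀ i j : ℤ, Q i j → ∀ η ∈ hexagonSet, ∀ i' j' : ℤ,
      (i' : ℝ) • (triangularVec₁ 2 : EuclideanSpace ℝ (Fin 3)) + (j' : ℝ) • triangularVec₂ 2 =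
        (i : ℝ) • (triangularVec₁ 2 : EuclideanSpace ℝ (Fin 3)) + (j : ℝ) • triangularVec₂ 2 + η →
      ‖((i' : ℝ) • (triangularVec₁ 2 : EuclideanSpace ℝ (Fin 3)) + (j' : ℝ) • triangularVec₂ 2) - c‖ ≤ R →
      Q i' j')
    {i₀ j₀ : ℤ}
    (h₀c : ‖((i₀ : ℝ) • (triangularVec₁ 2 : EuclideanSpace ℝ (Fin 3)) + (j₀ : ℝ) • triangularVec₂ 2) - c‖ ^ 2
      ≤ 2)
    (h₀ : Q i₀ j₀) :
    ∀ i j : ℤ,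
      ‖((i : ℝ) • (triangularVec₁ 2 : EuclideanSpace ℝ (Fin 3)) + (j : ℝ) • triangularVec₂ 2) - c‖ ≤ R →
      Q i j := by
  set L : ℤ → ℤ → EuclideanSpace ℝ (Fin 3) := fun i j =>
    (i : ℝ) • (triangularVec₁ 2 : EuclideanSpace ℝ (Fin 3)) + (j : ℝ) • triangularVec₂ 2 with hL
  -- the base region: squared distance `≤ 8/5` from `c`
  have base : ∀ i j : ℤ, ‖L i j - c‖ ^ 2 ≤ 8 / 5 → ‖L i j - c‖ ≤ R → Q i j := by
    intro i j h85 hR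
    have hd : ‖L i j - L i₀ j₀‖ ^ 2 < 12 := by
      have h1 : ‖L i j - L i₀ j₀‖ ≤ ‖L i j - c‖ + ‖L i₀ j₀ - c‖ := by
        rw [norm_sub_rev (L i₀ j₀) c]
        have : L i j - L i₀ j₀ = (L i j - c) + (c - L i₀ j₀) := by abel
        rw [this]; exact norm_add_le _ _
      have ha : ‖L i j - c‖ ^ 2 ≤ 8 / 5 := h85
      have hb : ‖L i₀ j₀ - c‖ ^ 2 ≤ 2 := h₀c
      have h2 : ‖L i j - L i₀ j₀‖ ^ 2 ≤ (‖L i j - c‖ + ‖L i₀ j₀ - c‖) ^ 2 :=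
        pow_le_pow_left₀ (norm_nonneg _) h1 2
      have h3 : (‖L i j - c‖ + ‖L i₀ j₀ - c‖) ^ 2 ≤ 2 * (‖L i j - c‖ ^ 2 + ‖L i₀ j₀ - c‖ ^ 2) := by
        nlinarith [sq_nonneg (‖L i j - c‖ - ‖L i₀ j₀ - c‖)]
      linarith
    have hdiff : L i j - L i₀ j₀ = ((i - i₀ : ℤ) : ℝ) • (triangularVec₁ 2 : EuclideanSpace ℝ (Fin 3)) +
        ((j - j₀ : ℤ) : ℝ) • triangularVec₂ 2 := by
      simp only [hL]; push_cast; module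
    rw [hdiff] at hd
    rcases eq_zero_or_mem_hexagonSet_of_norm_sq_lt_twelve hd with h0 | hη
    · have hij : L i j = L i₀ j₀ := by rw [← sub_eq_zero, hdiff, h0]
      have e := congrArg (fun x : EuclideanSpace ℝ (Fin 3) => (x 0, x 1)) hij
      simp only [hL, PiLp.add_apply, PiLp.smul_apply, smul_eq_mul, frameU_apply_zero, frameU_apply_one,
        frameV_apply_zero, frameV_apply_one, mul_zero, zero_add, mul_one, Prod.mk.injEq] at e
      obtain ⟨e0, e1⟩ := e
      have h3 : Real.sqrt 3 ≠ 0 := by positivity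
      have hj : (j : ℝ) = j₀ := by
        have := mul_right_cancel₀ h3 (show (j : ℝ) * Real.sqrt 3 = j₀ * Real.sqrt 3 by linarith)
        exact this
      have hi : (i : ℝ) = i₀ := by linarith
      have hi' : i = i₀ := by exact_mod_cast hi
      have hj' : j = j₀ := by exact_mod_cast hj
      subst hi' hj'
      exact h₀
    · exact hstep i₀ j₀ h₀ _ hη i j (by push_cast; module) hR
  -- descent on `⌊3 ‖p − c‖²⌋`
  suffices key : ∀ n : ℕ, ∀ i j : ℤ, ⌊3 * ‖L i j - c‖ ^ 2⌋₊ = n → ‖L i j - c‖ ≤ R → Q i j by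
    intro i j hR; exact key _ i j rfl hR
  intro n
  induction n using Nat.strong_induction_on with
  | _ n ih =>
    intro i j hn hR
    by_cases h85 : ‖L i j - c‖ ^ 2 ≤ 8 / 5
    · exact base i j h85 hR
    · push Not at h85
      have ht : 4 / 3 * (13 / 12 : ℝ) ^ 2 < ‖L i j - c‖ ^ 2 := by linarith
      obtain ⟨η, hη, hlt⟩ := exists_mem_hexagonSet_norm_sq_lt (lattice_apply_two i j) hc
        (by norm_num) ht
      obtain ⟨a, b, hab⟩ := exists_int_of_mem_hexagonSet hη
      have he : L (i + a) (j + b) = L i j + η := by simp only [hL, hab]; push_cast; module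
      have hlt' : ‖L (i + a) (j + b) - c‖ ^ 2 < ‖L i j - c‖ ^ 2 - 1 / 3 := by
        rw [he]; linarith
      have hR' : ‖L (i + a) (j + b) - c‖ ≤ R := by
        have h1 : ‖L (i + a) (j + b) - c‖ ^ 2 ≤ ‖L i j - c‖ ^ 2 := by linarith
        exact ((pow_le_pow_iff_left₀ (norm_nonneg _) (norm_nonneg _) two_ne_zero).1 h1).trans hR
      have hn' : ⌊3 * ‖L (i + a) (j + b) - c‖ ^ 2⌋₊ < n := by
        rw [← hn]
        have h3 : 3 * ‖L (i + a) (j + b) - c‖ ^ 2 < 3 * ‖L i j - c‖ ^ 2 - 1 := by linarith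
        have h0 : (0 : ℝ) ≤ 3 * ‖L (i + a) (j + b) - c‖ ^ 2 := by positivity
        have h4 : (⌊3 * ‖L (i + a) (j + b) - c‖ ^ 2⌋₊ : ℝ) ≤ 3 * ‖L (i + a) (j + b) - c‖ ^ 2 :=
          Nat.floor_le h0
        have h5 : ⌊3 * ‖L (i + a) (j + b) - c‖ ^ 2⌋₊ + 1 ≤ ⌊3 * ‖L i j - c‖ ^ 2⌋₊ :=
          Nat.le_floor (by push_cast; linarith)
        omega
      have IH := ih _ hn' (i + a) (j + b) rfl hR'
      exact hstep (i + a) (j + b) IH (-η) (neg_mem_hexagonSet hη) i j (by rw [hab]; push_cast; module) hR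

end Disc

/-- **Registered sub-goal `ballPropagation_latticeDiscInduction`** of the crux item (disc
induction on the triangular lattice, in closed form): `lattice_disc_induction`. [folklore] -/
theorem ballPropagation_latticeDiscInduction :
    ∀ (Q : ℤ → ℤ → Prop) (c : EuclideanSpace ℝ (Fin 3)), c 2 = 0 → ∀ (R : ℝ), (∀ i j : ℤ, Q i j → ∀
    η ∈ Literature.Geometry.DiscreteGeometry.hexagonSet, ∀ i' j' : ℤ, (i' : ℝ) •
    (Literature.MathematicalPhysics.StatisticalMechanics.triangularVec₁ 2 : EuclideanSpace ℝ (Fin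
    3)) + (j' : ℝ) • Literature.MathematicalPhysics.StatisticalMechanics.triangularVec₂ 2 = (i : ℝ)
    • (Literature.MathematicalPhysics.StatisticalMechanics.triangularVec₁ 2 : EuclideanSpace ℝ (Fin
    3)) + (j : ℝ) • Literature.MathematicalPhysics.StatisticalMechanics.triangularVec₂ 2 + η →
    ‖((i' : ℝ) • (Literature.MathematicalPhysics.StatisticalMechanics.triangularVec₁ 2 :
    EuclideanSpace ℝ (Fin 3)) + (j' : ℝ) •
    Literature.MathematicalPhysics.StatisticalMechanics.triangularVec₂ 2) - c‖ ≤ R → Q i' j') → ∀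
    (i₀ j₀ : ℤ), ‖((i₀ : ℝ) • (Literature.MathematicalPhysics.StatisticalMechanics.triangularVec₁ 2
    : EuclideanSpace ℝ (Fin 3)) + (j₀ : ℝ) •
    Literature.MathematicalPhysics.StatisticalMechanics.triangularVec₂ 2) - c‖ ^ 2 ≤ 2 → Q i₀ j₀ →
    ∀ i j : ℤ, ‖((i : ℝ) • (Literature.MathematicalPhysics.StatisticalMechanics.triangularVec₁ 2 :
    EuclideanSpace ℝ (Fin 3)) + (j : ℝ) •
    Literature.MathematicalPhysics.StatisticalMechanics.triangularVec₂ 2) - c‖ ≤ R → Q i j :=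
  fun _ _ hc _ hstep _ _ h₀c h₀ => lattice_disc_induction hc hstep h₀c h₀

end Summit.AtomisticToContinuum.Crystallization.Theorems

end
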